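import Summits.HodgeConjecture.HodgeConjecture.Theorems.AnchorTransportVariationalHodgePadicGrothendieckExistenceProper
import Literature.AlgebraicGeometry.Modules.PullbackClosedImmersionUnitIso
import Literature.AlgebraicGeometry.Modules.PullbackUnitComp
import Literature.AlgebraicGeometry.Modules.PushforwardClosedImmersionExact
import Literature.AlgebraicGeometry.Modules.PushforwardClosedImmersionCoh
import Literature.AlgebraicGeometry.Resolution.ChowLemmaNoetherianRing
import Mathlib.AlgebraicGeometry.IdealSheaf.Functorial

/-!
# The unit bound of GW II Lemma 24.105 on `X` from the unit bound on the closed subscheme `V(𝒦)`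

Helper file toward row b03 / crux `AnchorTransport.VariationalHodge` (stmt-HodgeConjecture-1076), line
padic-disc-transport, STUB P (`…_of_grothendieckExistence` rungs), continuing
`…AnchorTransportVariationalHodgePadicGrothendieckExistenceProper`, whose Grothendieck existence
theorem for a proper `X` is conditional on the inline hypothesis `hUB`: for every ideal sheaf `𝒦 ≠ ⊤`,
Chow data `ρ : X' → X` and an ideal `𝒥` of support `< supp 𝒦` bounding the units of all coherent
formal towers killed by `𝒦`. This file REDUCES `hUB` to Görtz–Wedhorn II Lemma 24.105 ON THE CLOSED
SUBSCHEME `Z = V(𝒦)` (Mathlib `𝒦.subscheme`), i.e. to the statement for towers on `Z` and a proper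
`π : Z' → Z` which is an isomorphism over a dense open `U ⊆ Z`:

* Chow's lemma for `Z → Spec A` (`Resolution.ChowLemmaRing.chow_proper_noetherian`) supplies `π`,
  the closed immersion `Z' ↪ ℙʳ_A` over `A`, and `U`; `ρ := π ≫ i` (`i : Z ↪ X`), and
  `𝒥 := (vanishing ideal of Z ∖ U).map i`, of support `i(Z ∖ U) ⊊ i(Z) = supp 𝒦`
  (`support_map_vanishingIdeal_lt`);
* for a module `M` on `X` killed by `𝒦 = ker i` the unit of `i` is an isomorphism
  (`Modules/PullbackClosedImmersionUnitIso`), so by the compatibility of units with composition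
  (`Modules/PullbackUnitComp`) the kernel and cokernel of the unit of `ρ` at `M` are `i_*` of those of
  the unit of `π` at `i^*M` (`i_*` is exact, `Modules/PushforwardClosedImmersionExact`);
* `i_*` carries a module killed by an ideal sheaf `ℐ` of `Z` to a module killed by `ℐ.map i`
  (`isKilledBy_map_pushforward`), and `(a)ᶜ·𝒥ᵈ ≤ ((a)ᶜ_Z·𝒥_Zᵈ).map i`;
* `unitBound_of_subscheme` — **the hypothesis `hUB` of `exists_coh_iso_cmplTower_of_unitBound` at
  `𝒦` follows from the unit bound for all coherent formal towers on `𝒦.subscheme`.**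

With `…GrothendieckExistenceUnitBoundAlgebraic` (the bound on `Z` for COMPLETION towers, GW II
24.105 step (I)), what remains for the unconditional theorem is exactly step (II) of GW II
Lemma 24.105 on `Z` (general coherent formal towers, by the flat base change `Spec B̂ → Spec B`).

HONEST FRAMING: research route conditional on HC_CM; not a corollary; Q11.4-sentence-2 already
refuted in dim ≥ 3. Nothing here bears on `HC_CM`; no case of the Hodge conjecture is proved.

References: GortzWedhorn2023 (II: proof of Lemma 24.103, Construction 24.104, Lemma 24.105,
pp. 571–575); GortzWedhorn2020 (I: Thm. 13.100, Chow's lemma); StacksProject (Tags 01QY, 088C, 0200).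
-/

set_option linter.dupNamespace false

noncomputable section

-- Summit.HodgeConjecture.HodgeConjecture.… repeats the summit name by the D-0017 layout (Sub = Summit).

-- `TopCat.Presheaf`/`Scheme.Modules` are not reducible (as in Mathlib's `AlgebraicGeometry/Modules`).
set_option backward.isDefEq.respectTransparency false

open CategoryTheory CategoryTheory.Limits AlgebraicGeometry TopologicalSpace Opposite
open Literature.AlgebraicGeometry.Modules Literature.AlgebraicGeometry.Morphisms
open Literature.AlgebraicGeometry.Morphisms.ProjCech
open Literature.AlgebraicGeometry.Resolution

universe u

namespace Summit.HodgeConjecture.HodgeConjecture.Theorems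

namespace GrothendieckExistenceProper

open FormalVectorBundlesAlgebraize

/-! ### `i_*` and ideal sheaves -/

section Pushforward

variable {Z X : Scheme.{u}} (i : Z ⟶ X) [IsAffineHom i]

/-- **`i_*` of a module killed by `ℐ` is killed by `ℐ.map i`** (`i` affine): on an affine `V`,
`(ℐ.map i)(V) = (i♯)⁻¹ ℐ(i⁻¹V)` (Mathlib `ideal_map_of_isAffineHom`) and `𝒪_X` acts on
`Γ(V, i_*N) = Γ(i⁻¹V, N)` through `i♯`. -/
theorem isKilledBy_map_pushforward {I : Z.IdealSheafData} {N : Z.Modules} (hN : IsKilledBy I N) :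
    IsKilledBy (I.map i) ((Scheme.Modules.pushforward i).obj N) := by
  intro V r hr s
  rw [Scheme.IdealSheafData.ideal_map_of_isAffineHom, Ideal.mem_comap] at hr
  rw [pushforward_smul]
  exact hN ⟨i ⁻¹ᵁ (V : X.Opens), V.2.preimage i⟩ _ hr _

/-- **`(a)·𝒪_X` is contained in `((i♯a)·𝒪_Z).map i`.** -/
theorem ofIdealTop_le_map (a : Γ(X, ⊤)) :
    Scheme.IdealSheafData.ofIdealTop (Ideal.span {a}) ≤
      (Scheme.IdealSheafData.ofIdealTop (Ideal.span {i.appTop a})).map i := by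
  refine Scheme.IdealSheafData.le_def.mpr fun V => ?_
  rw [Scheme.IdealSheafData.ideal_map_of_isAffineHom, Scheme.IdealSheafData.ofIdealTop_ideal,
    Scheme.IdealSheafData.ofIdealTop_ideal, Ideal.map_span, Set.image_singleton, Ideal.span_le,
    Set.singleton_subset_iff, SetLike.mem_coe, Ideal.mem_comap, Ideal.map_span, Set.image_singleton]
  change i.app V (X.presheaf.map (homOfLE le_top).op a) ∈ _
  rw [app_restrict_eq_restrict_appTop i a]
  exact Ideal.subset_span rfl

/-- **Monotonicity: `ℐ₁ᶜ·(ℐ₂.map i)ᵈ ≤ (ℐ₁'ᶜ·ℐ₂ᵈ).map i` when `ℐ₁ ≤ ℐ₁'.map i`** (`comap` of a product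
contains the product of the `comap`s). -/
theorem pow_mul_pow_le_map {I₁ : X.IdealSheafData} {I₁' I₂ : Z.IdealSheafData} (h : I₁ ≤ I₁'.map i)
    (c d : ℕ) : I₁ ^ c * I₂.map i ^ d ≤ (I₁' ^ c * I₂ ^ d).map i := by
  refine Scheme.IdealSheafData.le_def.mpr fun V => ?_
  have hV := Scheme.IdealSheafData.le_def.mp h V
  rw [Scheme.IdealSheafData.ideal_map_of_isAffineHom] at hV ⊢
  simp only [Scheme.IdealSheafData.ideal_mul, Scheme.IdealSheafData.ideal_pow, Pi.mul_apply,
    Pi.pow_apply, Scheme.IdealSheafData.ideal_map_of_isAffineHom]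
  exact (Ideal.mul_mono (Ideal.pow_right_mono hV c) le_rfl).trans
    ((Ideal.mul_mono (Ideal.le_comap_pow _ c) (Ideal.le_comap_pow _ d)).trans (Ideal.le_comap_mul _))

end Pushforward

/-! ### Kernel and cokernel of the unit of `π ≫ i` at a module killed by `ker i` -/

section Abstract

variable {C : Type*} [Category C] [Abelian C]

/-- Kernel and cokernel of `η ≫ φ ≫ e` with `η`, `e` isomorphisms are those of `φ`. -/
theorem nonempty_kernel_cokernel_iso_of_fac {M N P Q : C} (η : M ⟶ N) [IsIso η] (φ : N ⟶ P)
    (e : P ⟶ Q) [IsIso e] (θ : M ⟶ Q) (hfac : θ = η ≫ φ ≫ e) :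
    Nonempty (kernel θ ≅ kernel φ) ∧ Nonempty (cokernel θ ≅ cokernel φ) := by
  subst hfac
  exact ⟨⟨kernelIsIsoComp η (φ ≫ e) ≪≫ kernelCompMono φ e⟩,
    ⟨cokernelEpiComp η (φ ≫ e) ≪≫ cokernelCompIsIso φ e⟩⟩

end Abstract

section Unit

variable {Z' Z X : Scheme.{u}} (π : Z' ⟶ Z) (i : Z ⟶ X) [IsClosedImmersion i]

/-- **The unit of `π ≫ i` at `M` killed by `ker i`**: its kernel is isomorphic to `i_*` of the kernel
of the unit of `π` at `i^*M`, and likewise for the cokernel (the unit of `i` at `M` is an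
isomorphism, units compose, `i_*` is exact). [Stacks 01QY + EGA 0_I (4.4.3)] -/
theorem exists_kernel_cokernel_iso_of_isKilledBy_ker (M : X.Modules) (hM : IsAffineLocalizing M)
    (hK : IsKilledBy i.ker M) :
    Nonempty (kernel ((Scheme.Modules.pullbackPushforwardAdjunction (π ≫ i)).unit.app M) ≅
        (Scheme.Modules.pushforward i).obj
          (kernel ((Scheme.Modules.pullbackPushforwardAdjunction π).unit.app
            ((Scheme.Modules.pullback i).obj M)))) ∧
      Nonempty (cokernel ((Scheme.Modules.pullbackPushforwardAdjunction (π ≫ i)).unit.app M) ≅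
        (Scheme.Modules.pushforward i).obj
          (cokernel ((Scheme.Modules.pullbackPushforwardAdjunction π).unit.app
            ((Scheme.Modules.pullback i).obj M)))) := by
  haveI := isIso_unit_of_isKilledBy_ker i M hM hK
  -- the unit of `π ≫ i`, up to isomorphisms on both sides, is `i_*` of the unit `ψ` of `π` at `i^*M`
  have h := unit_comp_map_pullbackComp_inv π i M
  obtain ⟨ψ, hψ⟩ : ∃ ψ, (Scheme.Modules.pullbackPushforwardAdjunction π).unit.app
      ((Scheme.Modules.pullback i).obj M) = ψ := ⟨_, rfl⟩
  obtain ⟨A, hA⟩ : ∃ A, (Scheme.Modules.pushforward (π ≫ i)).map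
      ((Scheme.Modules.pullbackComp π i).inv.app M) = A := ⟨_, rfl⟩
  obtain ⟨E, hE⟩ : ∃ E, (Scheme.Modules.pushforwardComp π i).hom.app ((Scheme.Modules.pullback π).obj
      ((Scheme.Modules.pullback i).obj M)) = E := ⟨_, rfl⟩
  haveI : IsIso A := by rw [← hA]; infer_instance
  haveI : IsIso E := by rw [← hE]; infer_instance
  rw [hψ, hA, hE] at h
  have hfac : (Scheme.Modules.pullbackPushforwardAdjunction (π ≫ i)).unit.app M =
      (Scheme.Modules.pullbackPushforwardAdjunction i).unit.app M ≫
        (Scheme.Modules.pushforward i).map ψ ≫ (E ≫ inv A) := by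
    rw [← (IsIso.comp_inv_eq A).mpr h.symm]
    simp only [Category.assoc]
  obtain ⟨⟨ek⟩, ⟨ec⟩⟩ := nonempty_kernel_cokernel_iso_of_fac _ _ _ _ hfac
  rw [hψ]
  exact ⟨⟨ek ≪≫ (PreservesKernel.iso (Scheme.Modules.pushforward i) ψ).symm⟩,
    ⟨ec ≪≫ (PreservesCokernel.iso (Scheme.Modules.pushforward i) ψ).symm⟩⟩

end Unit

/-! ### The unit bound on `X` from the unit bound on `V(𝒦)` -/

section Subscheme

variable {A : Type u} [CommRing A] [IsNoetherianRing A] {X : Scheme.{u}} (f : X ⟶ Spec (.of A))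
  [IsProper f] (a₀ : A) [IsLocallyNoetherian X] [CompactSpace X]

omit [IsNoetherianRing A] [IsProper f] [IsLocallyNoetherian X] [CompactSpace X] in
/-- The support of `(vanishing ideal of Z ∖ U).map i`, `i : Z = V(𝒦) ↪ X`, is strictly smaller
than the support of `𝒦` when `U ⊆ Z` is dense and `𝒦 ≠ ⊤`. -/
theorem support_map_vanishingIdeal_lt (K : X.IdealSheafData) (hK : K ≠ ⊤)
    (U : (K.subscheme).Opens) (hU : Dense (U : Set K.subscheme)) :
    ((Scheme.IdealSheafData.vanishingIdeal U.compl).map K.subschemeι).support < K.support := by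
  have hrange : Set.range K.subschemeι = (K.support : Set X) := by
    exact_mod_cast Scheme.IdealSheafData.range_subschemeι K
  have hJ : (((Scheme.IdealSheafData.vanishingIdeal U.compl).map K.subschemeι).support : Set X) =
      K.subschemeι '' (U : Set K.subscheme)ᶜ := by
    rw [Scheme.IdealSheafData.support_map, TopologicalSpace.Closeds.coe_closure,
      Scheme.IdealSheafData.coe_support_vanishingIdeal]
    exact (K.subschemeι.isClosedEmbedding.isClosedMap _ U.isOpen.isClosed_compl).closure_eq
  refine lt_of_le_of_ne ?_ ?_
  · rw [← SetLike.coe_subset_coe, hJ, ← hrange]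
    exact Set.image_subset_range _ _
  · intro heq
    have hne : (K.support : Set X).Nonempty := by
      rw [Set.nonempty_iff_ne_empty]
      intro h0
      apply hK
      rw [← Scheme.IdealSheafData.support_eq_bot_iff]
      exact_mod_cast h0
    rw [← hrange] at hne
    obtain ⟨_, z₀, rfl⟩ := hne
    haveI : Nonempty K.subscheme := ⟨z₀⟩
    obtain ⟨z, hz⟩ := hU.nonempty
    have hmem : K.subschemeι z ∈ (K.support : Set X) := by rw [← hrange]; exact ⟨z, rfl⟩
    rw [← heq, hJ] at hmem
    obtain ⟨z', hz', hzz'⟩ := hmem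
    exact hz' (K.subschemeι.isClosedEmbedding.injective hzz' ▸ hz)

omit [CompactSpace X] in
/-- **The hypothesis `hUB` of `exists_coh_iso_cmplTower_of_unitBound` at `𝒦 ≠ ⊤` follows from
GW II Lemma 24.105 on the closed subscheme `Z = V(𝒦)`**: for every proper `π : Z' → Z` which is an
isomorphism over a (dense) open `U ⊆ Z` and every coherent formal tower `𝓖` on `Z` (along
`a = a₀·1`), the units `𝓖_n → π_*π^*𝓖_n` have kernels and cokernels killed by `(a)ᶜ·𝒥_Zᵈ` for one
`(c, d)`, `𝒥_Z` the vanishing ideal of `Z ∖ U`. (Chow's lemma for `Z`; the unit of the closed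
immersion `i : Z ↪ X` at a module killed by `𝒦` is an isomorphism; `i_*` is exact and carries
`ℐ`-killed modules to `ℐ.map i`-killed modules.) -/
theorem unitBound_of_subscheme (K : X.IdealSheafData) (hK : K ≠ ⊤)
    (hZ : ∀ (Z' : Scheme.{u}) (π : Z' ⟶ K.subscheme) [IsProper π] (U : (K.subscheme).Opens),
      Dense (U : Set K.subscheme) → IsIso (π ∣_ U) → ∀ 𝓖 : ℕᵒᵖ ⥤ (K.subscheme).Modules,
      IsFormalTower (algebraMapΓ (K.subschemeι ≫ f) a₀) 𝓖 → (∀ n, Coh (𝓖.obj ⟨n⟩)) →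
      ∃ c d : ℕ, ∀ n : ℕ,
        IsKilledBy (Scheme.IdealSheafData.ofIdealTop
              (Ideal.span {algebraMapΓ (K.subschemeι ≫ f) a₀}) ^ c *
            Scheme.IdealSheafData.vanishingIdeal U.compl ^ d)
          (kernel ((Scheme.Modules.pullbackPushforwardAdjunction π).unit.app (𝓖.obj ⟨n⟩))) ∧
        IsKilledBy (Scheme.IdealSheafData.ofIdealTop
              (Ideal.span {algebraMapΓ (K.subschemeι ≫ f) a₀}) ^ c *
            Scheme.IdealSheafData.vanishingIdeal U.compl ^ d)
          (cokernel ((Scheme.Modules.pullbackPushforwardAdjunction π).unit.app (𝓖.obj ⟨n⟩)))) :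
    ∃ (X' : Scheme.{u}) (ρ : X' ⟶ X) (_ : IsProper ρ) (r : ℕ) (ι₀ : X' ⟶ PP A r)
      (_ : IsClosedImmersion ι₀) (_ : ρ ≫ f = strZ ι₀) (J : X.IdealSheafData)
      (_ : J.support < K.support),
      ∀ 𝓕 : ℕᵒᵖ ⥤ X.Modules, IsFormalTower (algebraMapΓ f a₀) 𝓕 → (∀ n, Coh (𝓕.obj ⟨n⟩)) →
        (∀ n, IsKilledBy K (𝓕.obj ⟨n⟩)) →
        ∃ c d : ℕ, ∀ n : ℕ,
          IsKilledBy (Scheme.IdealSheafData.ofIdealTop (Ideal.span {algebraMapΓ f a₀}) ^ c * J ^ d)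
              (kernel ((Scheme.Modules.pullbackPushforwardAdjunction ρ).unit.app (𝓕.obj ⟨n⟩))) ∧
            IsKilledBy (Scheme.IdealSheafData.ofIdealTop (Ideal.span {algebraMapΓ f a₀}) ^ c * J ^ d)
              (cokernel ((Scheme.Modules.pullbackPushforwardAdjunction ρ).unit.app (𝓕.obj ⟨n⟩))) := by
  haveI : IsLocallyNoetherian K.subscheme := LocallyOfFiniteType.isLocallyNoetherian K.subschemeι
  -- Chow's lemma for `Z = V(𝒦) → Spec A`
  obtain ⟨r, Z', π, ι, hι, hπ, -, hcomm, U, hUd, hUiso⟩ :=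
    ChowLemmaRing.chow_proper_noetherian A K.subscheme (K.subschemeι ≫ f)
  haveI := hι
  haveI := hπ
  have hw : (π ≫ K.subschemeι) ≫ f = strZ ι := by rw [Category.assoc]; exact hcomm.symm
  refine ⟨Z', π ≫ K.subschemeι, inferInstance, r, ι, hι, hw,
    (Scheme.IdealSheafData.vanishingIdeal U.compl).map K.subschemeι,
    support_map_vanishingIdeal_lt K hK U hUd, fun 𝓕 hT hTc hTK => ?_⟩
  -- the tower restricted to `Z`
  have ha : K.subschemeι.appTop (algebraMapΓ f a₀) = algebraMapΓ (K.subschemeι ≫ f) a₀ :=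
    Sections.appTop_algebraMapΓ f (K.subschemeι ≫ f) K.subschemeι rfl a₀
  have hG : IsFormalTower (algebraMapΓ (K.subschemeι ≫ f) a₀)
      (𝓕 ⋙ Scheme.Modules.pullback K.subschemeι) := by
    rw [← ha]; exact hT.comp_pullback K.subschemeι _
  have hGc : ∀ n, Coh ((𝓕 ⋙ Scheme.Modules.pullback K.subschemeι).obj ⟨n⟩) :=
    coh_comp_pullback K.subschemeι hTc
  obtain ⟨c, d, hcd⟩ := hZ Z' π U hUd hUiso _ hG hGc
  refine ⟨c, d, fun n => ?_⟩
  obtain ⟨⟨ek⟩, ⟨ec⟩⟩ := exists_kernel_cokernel_iso_of_isKilledBy_ker π K.subschemeι (𝓕.obj ⟨n⟩)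
    (hTc n).loc (by rw [Scheme.IdealSheafData.ker_subschemeι]; exact hTK n)
  have hle : Scheme.IdealSheafData.ofIdealTop (Ideal.span {algebraMapΓ f a₀}) ^ c *
      (Scheme.IdealSheafData.vanishingIdeal U.compl).map K.subschemeι ^ d ≤
      (Scheme.IdealSheafData.ofIdealTop (Ideal.span {algebraMapΓ (K.subschemeι ≫ f) a₀}) ^ c *
        Scheme.IdealSheafData.vanishingIdeal U.compl ^ d).map K.subschemeι := by
    rw [← ha]
    exact pow_mul_pow_le_map K.subschemeι (ofIdealTop_le_map K.subschemeι (algebraMapΓ f a₀)) c d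
  exact ⟨isKilledBy_of_iso ek.symm
      (IsKilledBy.anti hle (isKilledBy_map_pushforward K.subschemeι (hcd n).1)),
    isKilledBy_of_iso ec.symm
      (IsKilledBy.anti hle (isKilledBy_map_pushforward K.subschemeι (hcd n).2))⟩

/-- **Grothendieck's existence theorem for a proper scheme, modulo GW II Lemma 24.105 on the closed
subschemes `V(𝒦)`**: every coherent formal tower along `a` on `X` proper over the `a`-adically
complete noetherian `A` is the completion tower of a coherent `𝒪_X`-module, granted, for every
`𝒦 ≠ ⊤`, the uniform unit bound for all coherent formal towers on `𝒦.subscheme` and every proper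
cover of it which is an isomorphism over a dense open. -/
theorem exists_coh_iso_cmplTower_of_subschemeUnitBound [IsAdicComplete (Ideal.span {a₀}) A]
    (h : ∀ (K : X.IdealSheafData), K ≠ ⊤ →
      ∀ (Z' : Scheme.{u}) (π : Z' ⟶ K.subscheme) [IsProper π] (U : (K.subscheme).Opens),
      Dense (U : Set K.subscheme) → IsIso (π ∣_ U) → ∀ 𝓖 : ℕᵒᵖ ⥤ (K.subscheme).Modules,
      IsFormalTower (algebraMapΓ (K.subschemeι ≫ f) a₀) 𝓖 → (∀ n, Coh (𝓖.obj ⟨n⟩)) →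
      ∃ c d : ℕ, ∀ n : ℕ,
        IsKilledBy (Scheme.IdealSheafData.ofIdealTop
              (Ideal.span {algebraMapΓ (K.subschemeι ≫ f) a₀}) ^ c *
            Scheme.IdealSheafData.vanishingIdeal U.compl ^ d)
          (kernel ((Scheme.Modules.pullbackPushforwardAdjunction π).unit.app (𝓖.obj ⟨n⟩))) ∧
        IsKilledBy (Scheme.IdealSheafData.ofIdealTop
              (Ideal.span {algebraMapΓ (K.subschemeι ≫ f) a₀}) ^ c *
            Scheme.IdealSheafData.vanishingIdeal U.compl ^ d)
          (cokernel ((Scheme.Modules.pullbackPushforwardAdjunction π).unit.app (𝓖.obj ⟨n⟩))))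
    {𝓕 : ℕᵒᵖ ⥤ X.Modules} (hT : IsFormalTower (algebraMapΓ f a₀) 𝓕) (hTc : ∀ n, Coh (𝓕.obj ⟨n⟩)) :
    ∃ F : X.Modules, Coh F ∧ Nonempty (𝓕 ≅ cmplTower (algebraMapΓ f a₀) F) :=
  exists_coh_iso_cmplTower_of_unitBound f a₀
    (fun K hK => unitBound_of_subscheme f a₀ K hK (h K hK)) hT hTc

end Subscheme

/-! ### Vector bundles on proper `W(k)`-schemes, modulo Lemma 24.105 on closed subschemes -/

section Witt

open Literature.AlgebraicGeometry.Motives Literature.AlgebraicGeometry.Motives.WittScheme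

/-- **`Motives.GrothendieckExistence_vectorBundle_witt` follows from GW II Lemma 24.105 on the closed
subschemes of proper `W(k)`-schemes**: the remaining input is, for every proper `𝒳 / W(k)`, every
ideal sheaf `𝒦 ≠ ⊤` of `𝒳`, every proper `π : Z' → 𝒦.subscheme` which is an isomorphism over a dense
open `U`, and every coherent formal tower `𝓖` on `𝒦.subscheme` along `p`, a pair `(c, d)` with the
kernels and cokernels of all units `𝓖_n → π_*π^*𝓖_n` killed by `(p)ᶜ·𝒥_Uᵈ` (`𝒥_U` the vanishing
ideal of the complement of `U`). Step (I) of that lemma (completion towers) is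
`exists_unitBound_cmplObj` (`…GrothendieckExistenceUnitBoundAlgebraic`). -/
theorem grothendieckExistence_vectorBundle_witt_of_subschemeUnitBound
    (h : ∀ (p : ℕ) [Fact p.Prime] (k : Type) [Field k] [CharP k p] [PerfectRing k p]
      (𝒳 : SchemeOver (WittVector p k)), IsProper 𝒳.hom →
      ∀ (K : 𝒳.left.IdealSheafData), K ≠ ⊤ →
      ∀ (Z' : Scheme.{0}) (π : Z' ⟶ K.subscheme) [IsProper π] (U : (K.subscheme).Opens),
      Dense (U : Set K.subscheme) → IsIso (π ∣_ U) → ∀ 𝓖 : ℕᵒᵖ ⥤ (K.subscheme).Modules,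
      IsFormalTower (algebraMapΓ (K.subschemeι ≫ 𝒳.hom) (p : WittVector p k)) 𝓖 →
      (∀ n, Coh (𝓖.obj ⟨n⟩)) →
      ∃ c d : ℕ, ∀ n : ℕ,
        IsKilledBy (Scheme.IdealSheafData.ofIdealTop
              (Ideal.span {algebraMapΓ (K.subschemeι ≫ 𝒳.hom) (p : WittVector p k)}) ^ c *
            Scheme.IdealSheafData.vanishingIdeal U.compl ^ d)
          (kernel ((Scheme.Modules.pullbackPushforwardAdjunction π).unit.app (𝓖.obj ⟨n⟩))) ∧
        IsKilledBy (Scheme.IdealSheafData.ofIdealTop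
              (Ideal.span {algebraMapΓ (K.subschemeι ≫ 𝒳.hom) (p : WittVector p k)}) ^ c *
            Scheme.IdealSheafData.vanishingIdeal U.compl ^ d)
          (cokernel ((Scheme.Modules.pullbackPushforwardAdjunction π).unit.app (𝓖.obj ⟨n⟩)))) :
    GrothendieckExistence_vectorBundle_witt.{0} := by
  refine grothendieckExistence_vectorBundle_witt_of_unitBound fun p _ k _ _ _ 𝒳 h𝒳 K hK => ?_
  haveI := h𝒳
  haveI : IsLocallyNoetherian 𝒳.left := ⟨fun U => isNoetherianRing_sections 𝒳 U.2⟩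
  exact unitBound_of_subscheme 𝒳.hom (p : WittVector p k) K hK (h p k 𝒳 h𝒳 K hK)

end Witt


end GrothendieckExistenceProper

end Summit.HodgeConjecture.HodgeConjecture.Theorems

end
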